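import Literature.AlgebraicGeometry.Modules.RelativeModuleCechPerfect
import Literature.AlgebraicGeometry.Modules.ModuleCechStratumFinite
import HarnessLib

/-!
# RELATIVE EDITION (ring base `R`) — Finiteness of the module Čech cohomology of a line bundle on an integral closed stratum,
# and the perfectness of the module Čech complex of a line bundle on `P ×_R T` (GW II Thm. 23.17, Cor. 23.135)

RELATIVE EDITION of ★ `Modules/ModuleCechStratumFinite` (cell `hodgecm-mathlib`, F-DAG hand (h8-E) «engine of the relative
seesaw», file E5; author B-p08 (g12); port map `B-provers/B-p08/g11/PORTMAP-h8-RelativeSeesaw.B-p08g11.md`): the ★ file՚s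
§Strata/§Final are typed `{K : Type u} [Field K] (P T : SchemeOver K)` and use the field nowhere — integrality of the strata
total spaces is Mathlib՚s base-general `GeometricallyIntegral.isIntegral_of_isLocallyNoetherian` under the ★ binders
`[Flat P.hom] [UniversallyOpen P.hom]` (`Modules/RelativeAffineStrata`); the base-free finiteness theorem on ONE integral closed
subscheme ★ `Modules.module_finite_homology_cechComplex_of_integral` (Chow + coherent dévissage) and the bridge discharge ★
`lineBundleCechBridge_holds` are IMPORTED from ★, not copied.  Decl for decl the twin of ★ §Strata/§Final with `K ↦ R`
(namespace `Literature.AlgebraicGeometry.Modules.Relative`): `Relative.baseToStrataTotal_eq` · `stratumCechFinite_of_hasRank_one` ·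
`module_finite_homology_cechComplex_of_hasRank_one` · `exists_strictlyPerfect_quasiIso_cechComplex_of_hasRank_one` and the
unconditional primed heads `stratumCechFinite_of_hasRank_one'` · `module_finite_homology_cechComplex_of_hasRank_one'` ·
**`exists_strictlyPerfect_quasiIso_cechComplex_of_hasRank_one'`** (the Grothendieck complex of a line bundle on `P ×_R T`,
`P → Spec R` proper flat geometrically integral universally open, `T` affine noetherian).  Everything is proved; no named facts,
no `sorry`.  HC_CM is proved only modulo the 7 printed citations until rung 0 closes; this file asserts nothing about HC.
Original module docstring (read `K` as `R`):

Discharge of `Modules.StratumCechFinite` (`Modules/ModuleCechPerfect`) for a RANK-ONE `L`: on the integral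
stratum `Y = P ×_K Spec(A⧸𝔭) ↪ X = P ×_K T` (`Modules/AffineStrata`; `P` proper, geometrically integral and
flat over the field `K`, `A` noetherian) the module Čech complex of `g^*L` for the pulled-back cover `g⁻¹𝓥`
is compared — after PRUNING the members with empty trace, replacing `g^*L` by `𝒪_Y(D)` and reading sections of
`𝒪_Y(D)` in `K(Y)` (`lineBundleCechBridge_holds`) — with the ordered Čech complex of the coherent rank-one family
`t ↦ Γ(V_t, 𝒪_Y(D)) ⊆ K(Y)`, whose cohomology is finitely generated over `A` by ★
`Motives/CechComplexPseudoCoherentGeneralProofs` (Görtz–Wedhorn II, Thm. 23.17 / Cor. 23.18 via Chow's lemma).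
* **`Modules.stratumCechFinite_of_hasRank_one`** — `StratumCechFinite P T 𝓥 L` for `HasRank L 1`;
* **`Modules.module_finite_homology_cechComplex_of_hasRank_one'`**,
  **`Modules.exists_strictlyPerfect_quasiIso_cechComplex_of_hasRank_one'`** — the node's heads for line
  bundles: `Hⁱ(Č•(𝓥, L))` finitely generated over `A`, and a strictly perfect `K• → Č•(𝓥, L)` in degrees
  `[0, r]` (the Grothendieck complex; Görtz–Wedhorn II, Cor. 23.135; Mumford §5, Lemma 1; EGA III 6.10.5).

## References
* U. Görtz, T. Wedhorn, *Algebraic Geometry II: Cohomology of Schemes* (2023),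
  doi:10.1007/978-3-658-43031-3: Thm. 23.17 / Cor. 23.18; Thm. 23.133, Rem. 23.134, Cor. 23.135
  (pp. 354–355). [GortzWedhorn2023]
* D. Mumford, *Abelian Varieties*, TIFR Studies in Mathematics 5 (1970), §5. [MumfordAV1970]
* A. Grothendieck, EGA III₂ (Publ. Math. IHÉS 17, 1963), (6.10.5). [EGA3]
-/

set_option autoImplicit false

universe u

open CategoryTheory CategoryTheory.Limits AlgebraicGeometry TopologicalSpace Opposite MonoidalCategory
open CartesianMonoidalCategory TensorProduct
open Literature.AlgebraicGeometry.Motives Literature.Algebra.Homology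

set_option backward.isDefEq.respectTransparency false

noncomputable section

namespace Literature.AlgebraicGeometry.Modules

namespace Relative

/-! ### The strata of `P ×_R T`; the node's heads for line bundles -/

section Strata

variable {R : Type u} [CommRing R] (P T : SchemeOver R) [IsAffine T.left]
variable {ι : Type} [LinearOrder ι] [Fintype ι] (𝓥 : ι → (P ⊗ T).left.Opens) (L : (P ⊗ T).left.Modules)

/-- The structure map `A → Γ(P ×_R T_𝔭, 𝒪)` of `Modules/ModuleCechStrataBaseChange` is `(g ≫ pr_T)♯`. [folklore] [cite: GortzWedhorn2023, Thm. 23.133, proof, Step (I) (p. 354)] -/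
theorem baseToStrataTotal_eq (𝔭 : PrimeSpectrum Γ(T.left, ⊤)) :
    Relative.baseToStrataTotal P T 𝔭 = (Relative.strataMap P T 𝔭 ≫ (snd P T).left).appTop.hom := by
  have hsq : Relative.strataMap P T 𝔭 ≫ (snd P T).left = (snd P (Relative.stratum T 𝔭)).left ≫ (Relative.stratumι T 𝔭).left := by
    rw [Relative.strataMap, ← Over.comp_left, whiskerLeft_snd, Over.comp_left]
  rw [hsq, Scheme.Hom.comp_appTop]
  apply RingHom.ext
  intro a
  change Relative.stratumToTotal P T 𝔭 (Relative.baseToStratum T 𝔭 a) = (snd P (Relative.stratum T 𝔭)).left.appTop ((Relative.stratumι T 𝔭).left.appTop a)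
  rw [baseToStratum_apply]

variable (hV : ∀ s : Finset ι, s.Nonempty → IsAffineOpen (cechOpen 𝓥 s)) (hcov : ⨆ i, 𝓥 i = ⊤)

include hV hcov in
/-- **`StratumCechFinite` holds for a line bundle** (`HasRank L 1`) on `P ×_R T`, `P` proper geometrically
integral (flat, universally open) over `R`, `T` affine noetherian — GIVEN the bridge
(BR-1): each stratum `P ×_R Spec(A⧸𝔭)` is an integral closed subscheme of the proper `P ×_R T → T`, and
`module_finite_homology_cechComplex_of_integral` applies to `g^*L` (rank one) and the cover `g⁻¹𝓥`.
[cite: GortzWedhorn2023, Thm. 23.17] -/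
theorem stratumCechFinite_of_hasRank_one [IsProper P.hom] [GeometricallyIntegral P.hom] [Flat P.hom]
    [UniversallyOpen P.hom] [IsNoetherianRing Γ(T.left, ⊤)]
    [IsLocallyNoetherian T.left] (hbr : LineBundleCechBridge.{u}) (hL : HasRank L 1) :
    Relative.StratumCechFinite P T 𝓥 L := by
  intro 𝔭 i
  haveI : IsProper (snd P T).left := MorphismProperty.pullback_snd (P := @IsProper) _ _ inferInstance
  haveI : LocallyOfFiniteType (snd P T).left :=
    MorphismProperty.pullback_snd (P := @LocallyOfFiniteType) _ _ inferInstance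
  haveI : IsLocallyNoetherian (P ⊗ T).left := LocallyOfFiniteType.isLocallyNoetherian (snd P T).left
  have haff : ∀ s : Finset ι, s.Nonempty → IsAffineOpen (cechOpen (Relative.strataCover P T 𝔭 𝓥) s) := by
    intro s hs
    rw [cechOpen_strataCover]
    exact Relative.isAffineOpen_preimage_whiskerLeft_stratumι T P 𝔭 (hV s hs)
  have hcov' : ⨆ j, Relative.strataCover P T 𝔭 𝓥 j = ⊤ := by
    change ⨆ j, Relative.strataMap P T 𝔭 ⁻¹ᵁ 𝓥 j = ⊤
    rw [← Scheme.Hom.preimage_iSup, hcov, Scheme.Hom.preimage_top]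
  exact module_finite_homology_cechComplex_of_integral (snd P T).left (Relative.strataMap P T 𝔭)
    (Relative.strataCover P T 𝔭 𝓥) (Relative.strataMod P T 𝔭 L) hbr haff hcov' (hasRank_pullback _ hL)
    (Relative.baseToStrataTotal P T 𝔭) (Relative.baseToStrataTotal_eq P T 𝔭) i

include hV hcov in
/-- **`Hⁱ(Č•(𝓥, L))` is a finitely generated `A`-module for a line bundle `L` on `P ×_R T`** (`T` affine
noetherian; given the bridge (BR-1)). [cite: GortzWedhorn2023, Thm. 23.133, proof, Step (I) (p. 354)] -/
theorem module_finite_homology_cechComplex_of_hasRank_one [IsProper P.hom] [GeometricallyIntegral P.hom]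
    [Flat P.hom] [UniversallyOpen P.hom] [IsNoetherianRing Γ(T.left, ⊤)]
    [IsLocallyNoetherian T.left] (hbr : LineBundleCechBridge.{u}) (hL : HasRank L 1) (i : ℤ) :
    Module.Finite Γ(T.left, ⊤) ((cechComplex 𝓥 L (Relative.baseToTotal P T)).homology i) :=
  Relative.module_finite_homology_cechComplex P T 𝓥 L hV (HasRank.isFiniteLocallyFree' hL)
    (Relative.stratumCechFinite_of_hasRank_one P T 𝓥 L hV hcov hbr hL) i

include hV hcov in
/-- **The module Čech complex of a line bundle on `P ×_R T` over an affine noetherian `T` is strictly perfect**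
(given the bridge (BR-1)): a complex `K•` of finitely generated projective `A`-modules in degrees `[0, r]`
with a quasi-isomorphism `K• → Č•(𝓥, L)` — the Grothendieck complex (Görtz–Wedhorn II, Cor. 23.135;
Mumford §5, Lemma 1; EGA III 6.10.5). [cite: GortzWedhorn2023, Cor. 23.135 (p. 355)] -/
theorem exists_strictlyPerfect_quasiIso_cechComplex_of_hasRank_one [IsProper P.hom]
    [GeometricallyIntegral P.hom] [Flat P.hom] [UniversallyOpen P.hom]
    [IsNoetherianRing Γ(T.left, ⊤)] [IsLocallyNoetherian T.left] (hbr : LineBundleCechBridge.{u})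
    (hL : HasRank L 1) (r : ℕ) (hr : (Fintype.card ι : ℤ) ≤ r + 1) :
    ∃ (K : CochainComplex (ModuleCat.{u} Γ(T.left, ⊤)) ℤ) (ψ : K ⟶ cechComplex 𝓥 L (Relative.baseToTotal P T)),
      QuasiIso ψ ∧ K.IsStrictlyGE 0 ∧ K.IsStrictlyLE (r : ℤ) ∧
      ∀ n, Module.Finite Γ(T.left, ⊤) (K.X n) ∧ Module.Projective Γ(T.left, ⊤) (K.X n) :=
  Relative.exists_strictlyPerfect_quasiIso_cechComplex P T 𝓥 L hV (HasRank.isFiniteLocallyFree' hL)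
    (Relative.stratumCechFinite_of_hasRank_one P T 𝓥 L hV hcov hbr hL) r hr

end Strata

/-! ### The node's heads, unconditional -/

section Final

variable {R : Type u} [CommRing R] (P T : SchemeOver R) [IsAffine T.left]
variable {ι : Type} [LinearOrder ι] [Fintype ι] (𝓥 : ι → (P ⊗ T).left.Opens) (L : (P ⊗ T).left.Modules)
variable (hV : ∀ s : Finset ι, s.Nonempty → IsAffineOpen (cechOpen 𝓥 s)) (hcov : ⨆ i, 𝓥 i = ⊤)

include hV hcov in
/-- **`StratumCechFinite P T 𝓥 L` for a line bundle** (`HasRank L 1`) — unconditional. [cite: GortzWedhorn2023, Thm. 23.17] -/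
theorem stratumCechFinite_of_hasRank_one' [IsProper P.hom] [GeometricallyIntegral P.hom] [Flat P.hom]
    [UniversallyOpen P.hom] [IsNoetherianRing Γ(T.left, ⊤)] [IsLocallyNoetherian T.left] (hL : HasRank L 1) :
    Relative.StratumCechFinite P T 𝓥 L :=
  Relative.stratumCechFinite_of_hasRank_one P T 𝓥 L hV hcov lineBundleCechBridge_holds hL

include hV hcov in
/-- **N1 (1a-γ), HEAD 1: the module Čech cohomology `Hⁱ(Č•(𝓥, L))` of a line bundle `L` on `P ×_R T` — `P`
proper flat geometrically integral universally open over `R`, `T` affine with noetherian (possibly non-reduced) ring `A`,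
`𝓥` a finite cover of `P ×_R T` by affine opens with affine intersections — is a finitely generated `A`-module**
(Görtz–Wedhorn II, Thm. 23.133 Step (I) / Mumford §5; by dévissage over the prime strata `P ×_R Spec(A⧸𝔭)`,
base change, and the finiteness theorem Thm. 23.17 on each integral Relative.stratum).
[cite: GortzWedhorn2023, Thm. 23.133, proof, Step (I) (p. 354)] [cite: MumfordAV1970, §5, Lemma 1] -/
theorem module_finite_homology_cechComplex_of_hasRank_one' [IsProper P.hom] [GeometricallyIntegral P.hom]
    [Flat P.hom] [UniversallyOpen P.hom] [IsNoetherianRing Γ(T.left, ⊤)] [IsLocallyNoetherian T.left]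
    (hL : HasRank L 1) (i : ℤ) :
    Module.Finite Γ(T.left, ⊤) ((cechComplex 𝓥 L (Relative.baseToTotal P T)).homology i) :=
  Relative.module_finite_homology_cechComplex_of_hasRank_one P T 𝓥 L hV hcov lineBundleCechBridge_holds hL i

include hV hcov in
/-- **N1 (1a-γ), HEAD 2: the module Čech complex `Č•(𝓥, L)` of a line bundle on `P ×_R T` over an affine noetherian
`T` is strictly perfect**: there is a complex `K•` of finitely generated projective `A`-modules concentrated in
degrees `[0, r]` (`#ι ≤ r + 1`) and a quasi-isomorphism `K• → Č•(𝓥, L)` — the Grothendieck complex of `L`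
(Görtz–Wedhorn II, Cor. 23.135; Mumford, *Abelian Varieties*, §5, Lemma 1; EGA III 6.10.5), unconditional.
[cite: GortzWedhorn2023, Cor. 23.135 (p. 355)] [cite: MumfordAV1970, §5, Lemma 1] -/
theorem exists_strictlyPerfect_quasiIso_cechComplex_of_hasRank_one' [IsProper P.hom]
    [GeometricallyIntegral P.hom] [Flat P.hom] [UniversallyOpen P.hom]
    [IsNoetherianRing Γ(T.left, ⊤)] [IsLocallyNoetherian T.left]
    (hL : HasRank L 1) (r : ℕ) (hr : (Fintype.card ι : ℤ) ≤ r + 1) :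
    ∃ (K : CochainComplex (ModuleCat.{u} Γ(T.left, ⊤)) ℤ) (ψ : K ⟶ cechComplex 𝓥 L (Relative.baseToTotal P T)),
      QuasiIso ψ ∧ K.IsStrictlyGE 0 ∧ K.IsStrictlyLE (r : ℤ) ∧
      ∀ n, Module.Finite Γ(T.left, ⊤) (K.X n) ∧ Module.Projective Γ(T.left, ⊤) (K.X n) :=
  Relative.exists_strictlyPerfect_quasiIso_cechComplex_of_hasRank_one P T 𝓥 L hV hcov lineBundleCechBridge_holds hL r hr

end Final

end Relative

end Literature.AlgebraicGeometry.Modules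

end
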